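import Literature.Computability.QuantumComplexity.FortnowRogersFlipCounting
import Literature.Computability.Complexity.BakerGillSolovay
import Literature.Computability.Complexity.BrickAlgebra
import HarnessLib

/-!
# The Fortnow–Rogers oracle, I: stages, reference worlds and the oracle `C` (`BQP^C ⊆ P^C`, `UP ∩ coUP` witnesses)

Topic `Literature/Computability/QuantumComplexity`. First half of a proof, with no hypothesis, of
the core of Fortnow–Rogers 1999, Thm. 4.2 — an oracle `C` with `BQP^C ⊆ P^C` and
`P^C ≠ UP^C ∩ coUP^C` (tree fact `Literature.Barriers.QuantumAdvantage.fortnowRogers1999_thm42_core`)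
— in the tree's models (`BQPRel`: uniform Clifford+T families with XOR query gates; `PRel`: the
transcript model at `Oracle.ofLanguage C`). The printed proof joins a `PSPACE`-complete set to a
`UP ∩ coUP`-generic oracle (Fortnow–Rogers p. 7; Blum–Impagliazzo genericity for categoricity);
this proof replaces both ingredients by elementary ones already in the tree, keeping the printed
proof's two mechanisms — exactly one witness string per level, found by nobody in polynomial
time (diagonalization), and the BBBV bound (their Thm. 4.3) to show that quantum queries do not
notice where the witness is:

* **Ko's encoding technique** for `BQP^C ⊆ P^C` (as the tree's `BQPCollapsingOracle.lean`, but
  with a PROMISE GAP, `FortnowRogersWorlds.lean`): code strings `ccode x m C` are put into `C` iff the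
  circuit accepts with probability `≥ 2/3`, or `> 1/3` and the code is in a *reference world*; codes
  satisfying the `BQP` promise are thus valued correctly (`BQPRel_oracleC_subset_PRel`), while the
  value inside the gap is free for the diagonalization;
* **a Baker–Gill–Solovay diagonalization** for `L ∉ P^C` (as the tree's `BakerGillSolovay.lean`):
  the reserved strings `rsv z w` carry, for EVERY `z`, exactly one witness `w = b :: y`, `|y| = |z|`
  (so `L = {z | its witness starts with 1}` has `UP^C` verifiers for itself and its complement,
  `L_verifier`, `Lc_verifier`); at stage `i` the `i`-th (algorithm, polynomial) pair is run on
  `1ⁿ`, `n = lvl i`, against the reference world `W_i` (level `n` empty, codes above the level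
  canonical), its answer is contradicted by the bit `b`, and `y` is chosen among the candidates
  NOT NOTICED by the run: no queried string changes membership between `W_i` and the world
  `A_{i, b::y}` in which the witness is placed (`good_stTail`, from the counting bound of
  `FortnowRogersFlipCounting.lean`: a queried string of length `< 2ᵐ` notices at most `(144·4ᵐ)ᵐ` of the
  `2ⁿ = 2^{m⁴}` candidates).

This file: the stage lengths `lvl` (`n = t⁴` with `qᵢ(t⁴) < 2ᵗ`, `t ≥ 3`, spaced past the previous
query bound), the thresholds `thr` (`θᵢ = 6nᵢ + 13`) and last visible stage `IsTop`, placements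
`pl`, the reference world `Wof` and the worlds `Aof` of a stage with their thresholds/fallbacks,
the stage run (`stO`, `stRes`, `stQs`, `stBit`, `Good`, `stTail`, `mkStage`), the stages `st` (by
strong recursion, with the fixed-point equation `st_eq`), the oracle `oracleC` with
`BQP^C ⊆ P^C` (`BQPRel_oracleC_subset_PRel`), its reserved part and the language `L`
(`exists_wit`, `ones_mem_L_iff`), the candidate sets and the count `2ᵐ(144·4ᵐ)ᵐ < 2^{m⁴}`
(`cands`, `count_lt`), and the `UP`-verifiers of `L` and `Lᶜ` (`L_verifier`, `Lc_verifier`). The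
agreement lemmas, the existence of an unnoticed candidate (`good_stTail`), the diagonalization and
the main theorem are in `FortnowRogersOracle.lean`.

## References

* [FortnowRogers1999JCSS] L. Fortnow, J. Rogers, *Complexity limitations on quantum computation*,
  JCSS 59 (1999) 240–252 = arXiv:cs/9811023, Thm. 4.2 and its proof, Thm. 4.3 (pp. 7–8).
* [Ko1989] K.-I Ko, *Constructing oracles by lower bound techniques for circuits*, in:
  Combinatorics, Computing and Complexity (Kluwer, 1989) 30–76, §3 (stage constructions), §5 and
  p. 24 (encoding a complete set into the oracle).
* [AroraBarakCC2009] S. Arora, B. Barak, *Computational Complexity: A Modern Approach*, CUP 2009,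
  Thm. 3.7 (proof: diagonalization against the enumeration of `P^B` machines).
* [BennettBernsteinBrassardVazirani1997] C. H. Bennett, E. Bernstein, G. Brassard, U. Vazirani,
  *Strengths and weaknesses of quantum computing*, SIAM J. Comput. 26 (1997), Thm. 3.3, Cor. 3.4.
-/

noncomputable section

namespace Literature.Computability.QuantumComplexity

open _root_.Computability Complexity Complexity.Classes Cryptography Polynomial
open scoped Complexity.Notation

namespace FRO

variable (d : ℕ → OracleAlg Bool × Polynomial ℕ)

/-! ### Stage lengths -/

/-- A fresh parameter `t > N`, `t ≥ 3`, with `q(t⁴) < 2ᵗ` (every polynomial is eventually below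
`2ⁿ`, `BGS.exists_lt_two_pow`). [cite: AroraBarakCC2009, Thm. 3.7 (proof)] -/
theorem exists_param (q : Polynomial ℕ) (N : ℕ) : ∃ t : ℕ, N < t ∧ 3 ≤ t ∧ q.eval (t ^ 4) < 2 ^ t := by
  obtain ⟨t, ht, hq⟩ := BGS.exists_lt_two_pow (q.comp (X ^ 4)) (max N 2)
  refine ⟨t, lt_of_le_of_lt (le_max_left _ _) ht, ?_, by simpa [eval_comp] using hq⟩
  have := le_max_right N 2
  omega

/-- The chosen parameter. [cite: AroraBarakCC2009, Thm. 3.7 (proof)] -/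
def param (q : Polynomial ℕ) (N : ℕ) : ℕ :=
  Classical.choose (exists_param q N)

/-- Specification of the parameter. [cite: AroraBarakCC2009, Thm. 3.7 (proof)] -/
theorem param_spec (q : Polynomial ℕ) (N : ℕ) :
    N < param q N ∧ 3 ≤ param q N ∧ q.eval (param q N ^ 4) < 2 ^ param q N :=
  Classical.choose_spec (exists_param q N)

/-- The parameter `tᵢ` of stage `i` (input length `nᵢ = tᵢ⁴`), fresh above the previous stage's
query bound plus input length. [cite: Ko1989, §3 (p. 10)] -/
def tpar : ℕ → ℕ
  | 0 => param (d 0).2 0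
  | i + 1 => param (d (i + 1)).2 ((d i).2.eval (tpar i ^ 4) + tpar i ^ 4)

/-- The input length `nᵢ = tᵢ⁴` of stage `i`. [cite: Ko1989, §3 (p. 10)] -/
def lvl (i : ℕ) : ℕ :=
  tpar d i ^ 4

/-- The round and query bound `qᵢ(nᵢ)` of stage `i`. [cite: Ko1989, §3 (p. 10)] -/
def bnd (i : ℕ) : ℕ :=
  (d i).2.eval (lvl d i)

/-- `tᵢ ≥ 3`. [folklore] -/
theorem three_le_tpar (i : ℕ) : 3 ≤ tpar d i := by
  cases i with
  | zero => exact (param_spec _ _).2.1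
  | succ i => exact (param_spec _ _).2.1

/-- `qᵢ(nᵢ) < 2^{tᵢ}`. [folklore] -/
theorem bnd_lt_two_pow (i : ℕ) : bnd d i < 2 ^ tpar d i := by
  cases i with
  | zero => exact (param_spec _ _).2.2
  | succ i => exact (param_spec _ _).2.2

/-- `tᵢ ≤ nᵢ`. [folklore] -/
theorem tpar_le_lvl (i : ℕ) : tpar d i ≤ lvl d i := by
  unfold lvl
  calc tpar d i = tpar d i ^ 1 := (pow_one _).symm
    _ ≤ tpar d i ^ 4 := Nat.pow_le_pow_right (by have := three_le_tpar d i; omega) (by norm_num)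

/-- **Spacing**: `qᵢ(nᵢ) + nᵢ < nᵢ₊₁`. [cite: Ko1989, §3 (p. 10)] -/
theorem bnd_add_lvl_lt_lvl_succ (i : ℕ) : bnd d i + lvl d i < lvl d (i + 1) := by
  have h1 : (d i).2.eval (tpar d i ^ 4) + tpar d i ^ 4 < tpar d (i + 1) := (param_spec _ _).1
  exact lt_of_lt_of_le h1 (tpar_le_lvl d (i + 1))

/-- The input lengths increase strictly. [folklore] -/
theorem lvl_strictMono : StrictMono (lvl d) :=
  strictMono_nat_of_lt_succ fun i => by have := bnd_add_lvl_lt_lvl_succ d i; omega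

/-- The input lengths are injective. [folklore] -/
theorem lvl_injective : Function.Injective (lvl d) :=
  (lvl_strictMono d).injective

/-- `i ≤ nᵢ`. [folklore] -/
theorem le_lvl (i : ℕ) : i ≤ lvl d i :=
  (lvl_strictMono d).le_apply

/-- `3 ≤ nᵢ`. [folklore] -/
theorem three_le_lvl (i : ℕ) : 3 ≤ lvl d i :=
  (three_le_tpar d i).trans (tpar_le_lvl d i)

/-- Later input lengths exceed the query bound: `qᵢ(nᵢ) < nⱼ` for `i < j`. [folklore] -/
theorem bnd_lt_lvl_of_lt {i j : ℕ} (h : i < j) : bnd d i < lvl d j :=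
  lt_of_lt_of_le (by have := bnd_add_lvl_lt_lvl_succ d i; omega)
    ((lvl_strictMono d).monotone (show i + 1 ≤ j from h))

/-! ### The visibility threshold of a level -/

/-- The threshold `θᵢ = 6nᵢ + 13`: a code of length `≤ θᵢ` cannot query the reserved strings of
level `i` (of length `3nᵢ + 4`). [folklore] -/
def thr (i : ℕ) : ℕ :=
  6 * lvl d i + 13

/-- The thresholds increase strictly. [folklore] -/
theorem thr_strictMono : StrictMono (thr d) := fun i j h => by
  unfold thr
  have := lvl_strictMono d h
  omega

/-- The query bound of stage `i` is below the next threshold (indeed below the next length). [folklore] -/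
theorem bnd_lt_thr_succ (i : ℕ) : bnd d i < thr d (i + 1) := by
  have := bnd_add_lvl_lt_lvl_succ d i
  unfold thr
  omega

/-- `IsTop j ℓ`: `j` is the last stage visible from length `ℓ` (`θⱼ < ℓ`, maximal). [folklore] -/
def IsTop (j ℓ : ℕ) : Prop :=
  thr d j < ℓ ∧ ∀ j', thr d j' < ℓ → j' ≤ j

/-- The last visible stage is unique. [folklore] -/
theorem IsTop.unique {j j' ℓ : ℕ} (h : IsTop d j ℓ) (h' : IsTop d j' ℓ) : j = j' :=
  le_antisymm (h'.2 j h.1) (h.2 j' h'.1)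

/-- Between `θⱼ` (excluded) and `θⱼ₊₁` (included) the last visible stage is `j`. [folklore] -/
theorem isTop_of {j ℓ : ℕ} (h1 : thr d j < ℓ) (h2 : ℓ ≤ thr d (j + 1)) : IsTop d j ℓ :=
  ⟨h1, fun _ hj' => Nat.lt_succ_iff.1 ((thr_strictMono d).lt_iff_lt.1 (lt_of_lt_of_le hj' h2))⟩

/-- A stage visible from a length at most `θᵢ` is earlier than `i`. [folklore] -/
theorem IsTop.lt {j ℓ i : ℕ} (h : IsTop d j ℓ) (h' : ℓ ≤ thr d i) : j < i :=
  (thr_strictMono d).lt_iff_lt.1 (lt_of_lt_of_le h.1 h')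

/-! ### Placements of witnesses -/

/-- The default witness of `z`: `0^{|z|+1}` (a witness starting with `0`). [folklore] -/
def dflt (z : List Bool) : List Bool :=
  false :: List.replicate z.length false

open scoped Classical in
/-- The placement determined by an assignment `ch` of (optional) witnesses to the stage inputs
`1^{nⱼ}`: every other string gets its default witness. [cite: AroraBarakCC2009, Thm. 3.7 (proof)] -/
def pl (ch : ℕ → Option (List Bool)) (z : List Bool) : Option (List Bool) :=
  if h : ∃ j, z = ones (lvl d j) then ch (Classical.choose h) else some (dflt z)

/-- Stage inputs determine their stage. [folklore] -/
theorem eq_of_ones_lvl_eq {j j' : ℕ} (h : ones (lvl d j) = ones (lvl d j')) : j = j' :=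
  lvl_injective d (by simpa using congrArg List.length h)

/-- The placement at a stage input. [folklore] -/
theorem pl_ones (ch : ℕ → Option (List Bool)) (j : ℕ) : pl d ch (ones (lvl d j)) = ch j := by
  classical
  have h : ∃ j', ones (lvl d j) = ones (lvl d j') := ⟨j, rfl⟩
  rw [pl, dif_pos h, ← eq_of_ones_lvl_eq d (Classical.choose_spec h)]

/-- The placement off the stage inputs. [folklore] -/
theorem pl_of_ne (ch : ℕ → Option (List Bool)) {z : List Bool} (hz : ∀ j, z ≠ ones (lvl d j)) :
    pl d ch z = some (dflt z) := by
  classical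
  rw [pl, dif_neg]
  rintro ⟨j, hj⟩
  exact hz j hj

/-! ### Stages -/

/-- The data of a stage: its reference world `W`, and the witness `bit :: tail` placed at its
input. [cite: AroraBarakCC2009, Thm. 3.7 (proof)] -/
structure Stage where
  /-- the reference world of the stage (its level empty, codes above the level canonical) -/
  W : Set (List Bool)
  /-- the first bit of the witness (`true` iff the stage input is put into `L`) -/
  bit : Bool
  /-- the rest of the witness (a string of length `nᵢ` not noticed by the stage run) -/
  tail : List Bool

/-- The junk stage (empty world, witness `[false]`), used beyond the recursion horizon. [folklore] -/
instance : Inhabited Stage := ⟨⟨∅, false, []⟩⟩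

/-- The witness `bit :: tail` of a stage. [folklore] -/
def Stage.wit (S : Stage) : List Bool :=
  S.bit :: S.tail

section Rules

variable (G : ℕ → Stage) (i : ℕ)

/-- The final assignment: every stage input gets the witness of its stage. [folklore] -/
def chC : ℕ → Option (List Bool) := fun j => some (G j).wit

/-- The assignment of the reference world of stage `i`: earlier stages as decided, level `i`
EMPTY, later stage inputs defaulted. [cite: FortnowRogers1999JCSS, proof of Thm. 4.2 ("under the assumption that there are no strings of length ℓ in G")] -/
def chW : ℕ → Option (List Bool) := fun j =>
  if j < i then some (G j).wit else if j = i then none else some (dflt (ones (lvl d j)))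

/-- The assignment of the world `A_{i,w}`: as the reference world but with the candidate witness
`w` at level `i`. [cite: FortnowRogers1999JCSS, proof of Thm. 4.2] -/
def chA (w : List Bool) : ℕ → Option (List Bool) := fun j =>
  if j < i then some (G j).wit else if j = i then some w else some (dflt (ones (lvl d j)))

/-- Upper threshold of the oracle: canonical `1/2` below the first level, `2/3` above. [folklore] -/
def aC (ℓ : ℕ) : ℝ := if thr d 0 < ℓ then 2 / 3 else 1 / 2

/-- Lower threshold of the oracle: canonical `1/2` below the first level, `1/3` above. [folklore] -/
def bC (ℓ : ℕ) : ℝ := if thr d 0 < ℓ then 1 / 3 else 1 / 2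

/-- Fallback of the oracle: inside the promise gap a code takes its value in the reference world
of the last stage it can see. [folklore] -/
def refC (s : List Bool) : Prop := ∃ j, IsTop d j s.length ∧ s ∈ (G j).W

/-- Upper threshold of the reference world of stage `i`: canonical above `θᵢ`. [folklore] -/
def aW (ℓ : ℕ) : ℝ := if thr d i < ℓ then 1 / 2 else aC d ℓ

/-- Lower threshold of the reference world of stage `i`: canonical above `θᵢ`. [folklore] -/
def bW (ℓ : ℕ) : ℝ := if thr d i < ℓ then 1 / 2 else bC d ℓ

/-- Fallback of the reference world of stage `i` (none above `θᵢ`). [folklore] -/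
def refW (s : List Bool) : Prop := ¬ thr d i < s.length ∧ refC d G s

/-- Fallback of the worlds `A_{i,w}`: above `θᵢ`, the reference world `Wi` of stage `i`. [folklore] -/
def refA (Wi : Set (List Bool)) (s : List Bool) : Prop := if thr d i < s.length then s ∈ Wi else refC d G s

/-- **The reference world `W_i`** of stage `i` (given the earlier stages `G`). [cite: FortnowRogers1999JCSS, proof of Thm. 4.2] -/
def Wof : Set (List Bool) :=
  world (pl d (chW d G i)) (aW d i) (bW d i) (refW d G i)

/-- **The world `A_{i,w}`** in which the candidate witness `w` is placed at level `i` and the codes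
above `θᵢ` keep their `W_i`-value unless the promise forces otherwise. [cite: FortnowRogers1999JCSS, proof of Thm. 4.2] -/
def Aof (w : List Bool) : Set (List Bool) :=
  world (pl d (chA d G i w)) (aC d) (bC d) (refA d G i (Wof d G i))

/-- The oracle of the stage run: `W_i` truncated at the query bound. [cite: AroraBarakCC2009, Thm. 3.7 (proof, stage i)] -/
def stO : Oracle :=
  Oracle.ofLanguage (truncLang (Wof d G i) (bnd d i))

/-- The stage run: the `i`-th algorithm on `1^{nᵢ}` for `qᵢ(nᵢ)` rounds against `W_i`.
[cite: AroraBarakCC2009, Thm. 3.7 (proof, stage i)] -/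
def stRes : Option Bool :=
  (d i).1.run (stO d G i) (bnd d i) (ones (lvl d i))

/-- The queries of the stage run. [cite: AroraBarakCC2009, Thm. 3.7 (proof, stage i)] -/
def stQs : List (List Bool) :=
  (d i).1.queries (stO d G i) (bnd d i) (ones (lvl d i))

/-- The bit of stage `i`: contradict the stage run (`true` iff the run did not accept). [cite: AroraBarakCC2009, Thm. 3.7 (proof)] -/
def stBit : Bool :=
  decide (stRes d G i ≠ some true)

/-- A good tail: a string `y` of length `nᵢ` such that no query of the stage run (within the query
bound) changes membership between `W_i` and `A_{i, bit :: y}`. [cite: FortnowRogers1999JCSS, proof of Thm. 4.2] -/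
def Good (y : List Bool) : Prop :=
  y.length = lvl d i ∧
    ∀ u ∈ stQs d G i, u.length ≤ bnd d i → (u ∈ Aof d G i (stBit d G i :: y) ↔ u ∈ Wof d G i)

open scoped Classical in
/-- The tail of stage `i`: a good tail if there is one (there always is, `good_stTail`), junk
`0^{nᵢ}` otherwise. [cite: FortnowRogers1999JCSS, proof of Thm. 4.2] -/
def stTail : List Bool :=
  if h : ∃ y, Good d G i y then Classical.choose h else List.replicate (lvl d i) false

/-- **One stage.** [cite: AroraBarakCC2009, Thm. 3.7 (proof)] [cite: FortnowRogers1999JCSS, proof of Thm. 4.2] -/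
def mkStage : Stage :=
  ⟨Wof d G i, stBit d G i, stTail d G i⟩

end Rules

/-! ### The stages depend only on the earlier stages -/

section Congr

variable {G G' : ℕ → Stage} {i : ℕ}

/-- The fallback below `θᵢ` only consults earlier stages. [folklore] -/
theorem refC_congr (h : ∀ j < i, G j = G' j) {s : List Bool} (hs : s.length ≤ thr d i) :
    refC d G s ↔ refC d G' s := by
  constructor
  · rintro ⟨j, hj, hs'⟩
    exact ⟨j, hj, by rwa [← h j (hj.lt d hs)]⟩
  · rintro ⟨j, hj, hs'⟩
    exact ⟨j, hj, by rwa [h j (hj.lt d hs)]⟩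

/-- `W_i` depends only on the earlier stages. [folklore] -/
theorem Wof_congr (h : ∀ j < i, G j = G' j) : Wof d G i = Wof d G' i := by
  have h1 : chW d G i = chW d G' i := funext fun j => by
    unfold chW
    split_ifs with hj <;> simp [h j, hj]
  have h2 : refW d G i = refW d G' i := funext fun s => propext <| by
    unfold refW
    constructor
    · rintro ⟨hs, hr⟩
      exact ⟨hs, (refC_congr d h (not_lt.1 hs)).1 hr⟩
    · rintro ⟨hs, hr⟩
      exact ⟨hs, (refC_congr d h (not_lt.1 hs)).2 hr⟩
  rw [Wof, Wof, h1, h2]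

/-- `A_{i,w}` depends only on the earlier stages. [folklore] -/
theorem Aof_congr (h : ∀ j < i, G j = G' j) : Aof d G i = Aof d G' i := by
  funext w
  have h1 : chA d G i w = chA d G' i w := funext fun j => by
    unfold chA
    split_ifs with hj <;> simp [h j, hj]
  have h2 : refA d G i (Wof d G i) = refA d G' i (Wof d G' i) := funext fun s => propext <| by
    unfold refA
    split_ifs with hs
    · rw [Wof_congr d h]
    · exact refC_congr d h (not_lt.1 hs)
  rw [Aof, Aof, h1, h2]

/-- A stage depends only on the earlier stages. [folklore] -/
theorem mkStage_congr (h : ∀ j < i, G j = G' j) : mkStage d G i = mkStage d G' i := by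
  have hW := Wof_congr d h
  have hA := Aof_congr d h
  have hO : stO d G i = stO d G' i := by rw [stO, stO, hW]
  have hR : stRes d G i = stRes d G' i := by rw [stRes, stRes, hO]
  have hQ : stQs d G i = stQs d G' i := by rw [stQs, stQs, hO]
  have hB : stBit d G i = stBit d G' i := by rw [stBit, stBit, hR]
  have hG : Good d G i = Good d G' i := by
    funext y
    rw [Good, Good, hQ, hA, hB, hW]
  have hT : stTail d G i = stTail d G' i := by rw [stTail, stTail, hG]
  rw [mkStage, mkStage, hW, hB, hT]

end Congr

/-- **The stages**, by strong recursion. [cite: AroraBarakCC2009, Thm. 3.7 (proof)] -/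
def st : ℕ → Stage :=
  Nat.strongRec fun i prev => mkStage d (fun j => if h : j < i then prev j h else default) i

/-- **The fixed-point equation of the stages**: stage `i` is computed from the sequence of all
stages (of which it only consults the earlier ones). [folklore] -/
theorem st_eq (i : ℕ) : st d i = mkStage d (st d) i := by
  rw [st, Nat.strongRec_eq]
  exact mkStage_congr d fun j hj => by simp [hj, st]

/-- The reference world of stage `i` is `W_i`. [folklore] -/
theorem st_W (i : ℕ) : (st d i).W = Wof d (st d) i := by
  rw [st_eq]; rfl

/-- The bit of stage `i`. [folklore] -/
theorem st_bit (i : ℕ) : (st d i).bit = stBit d (st d) i := by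
  rw [st_eq]; rfl

/-- The tail of stage `i`. [folklore] -/
theorem st_tail (i : ℕ) : (st d i).tail = stTail d (st d) i := by
  rw [st_eq]; rfl

/-! ### The oracle -/

/-- **The oracle `C`**: witnesses as decided by the stages (defaults elsewhere), codes with the
promise gap and fallback to the reference world of the last visible stage.
[cite: FortnowRogers1999JCSS, Thm. 4.2 (arXiv numbering)] [cite: Ko1989, p. 24 (2)] -/
def oracleC : Set (List Bool) :=
  world (pl d (chC (st d))) (aC d) (bC d) (refC d (st d))

/-- The thresholds of the oracle lie in the promise gap. [folklore] -/
theorem aC_le (ℓ : ℕ) : aC d ℓ ≤ 2 / 3 := by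
  unfold aC; split_ifs <;> norm_num

/-- The thresholds of the oracle lie in the promise gap. [folklore] -/
theorem lt_aC (ℓ : ℕ) : 1 / 3 < aC d ℓ := by
  unfold aC; split_ifs <;> norm_num

/-- The thresholds of the oracle lie in the promise gap. [folklore] -/
theorem le_bC (ℓ : ℕ) : 1 / 3 ≤ bC d ℓ := by
  unfold bC; split_ifs <;> norm_num

/-- **`BQP^C ⊆ P^C`.** [cite: FortnowRogers1999JCSS, Thm. 4.2 (arXiv numbering)] [cite: Ko1989, §5 (p. 21) and p. 24 (2)] -/
theorem BQPRel_oracleC_subset_PRel : BQPRel (oracleC d) ⊆ PRel (Oracle.ofLanguage (oracleC d)) :=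
  BQPRel_world_subset_PRel _ _ (aC_le d) (lt_aC d) (le_bC d)

/-! ### The reserved part of the oracle and the language `L` -/

/-- Reserved strings of the oracle. [folklore] -/
theorem rsv_mem_oracleC_iff (z w : List Bool) : rsv z w ∈ oracleC d ↔ pl d (chC (st d)) z = some w :=
  rsv_mem_world_iff _ _ _ _ z w

/-- The witness of a stage input is the witness of its stage. [folklore] -/
theorem rsv_ones_mem_oracleC_iff (j : ℕ) (w : List Bool) :
    rsv (ones (lvl d j)) w ∈ oracleC d ↔ w = (st d j).wit := by
  rw [rsv_mem_oracleC_iff, pl_ones]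
  simp only [chC, Option.some.injEq]
  exact eq_comm

/-- The witness of any other string is its default witness. [folklore] -/
theorem rsv_mem_oracleC_iff_of_ne {z : List Bool} (hz : ∀ j, z ≠ ones (lvl d j)) (w : List Bool) :
    rsv z w ∈ oracleC d ↔ w = dflt z := by
  rw [rsv_mem_oracleC_iff, pl_of_ne d _ hz]
  simp only [Option.some.injEq]
  exact eq_comm

/-- **The language `L`**: the strings whose witness starts with `1`. [cite: FortnowRogers1999JCSS, proof of Thm. 4.2 (the language L^X)] -/
def L : Language Bool :=
  {z | ∃ y : List Bool, y.length ≤ z.length ∧ rsv z (true :: y) ∈ oracleC d}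

/-- The stage tail has length `nᵢ`. [folklore] -/
theorem length_stTail (G : ℕ → Stage) (i : ℕ) : (stTail d G i).length = lvl d i := by
  classical
  unfold stTail
  split_ifs with h
  · exact (Classical.choose_spec h).1
  · simp

/-- Every string has exactly one witness, of the form `b :: y` with `|y| = |z|`. [folklore] -/
theorem exists_wit (z : List Bool) :
    ∃ (b : Bool) (y : List Bool), y.length = z.length ∧ ∀ w, (rsv z w ∈ oracleC d ↔ w = b :: y) := by
  by_cases hz : ∃ j, z = ones (lvl d j)
  · obtain ⟨j, rfl⟩ := hz
    refine ⟨(st d j).bit, (st d j).tail, ?_, fun w => rsv_ones_mem_oracleC_iff d j w⟩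
    rw [st_tail, length_stTail]
    simp
  · push Not at hz
    exact ⟨false, List.replicate z.length false, by simp, fun w => rsv_mem_oracleC_iff_of_ne d hz w⟩

/-- Membership in `L` in terms of the witness. [folklore] -/
theorem mem_L_iff {z : List Bool} {b : Bool} {y : List Bool} (hy : y.length = z.length)
    (h : ∀ w, (rsv z w ∈ oracleC d ↔ w = b :: y)) : z ∈ L d ↔ b = true := by
  constructor
  · rintro ⟨y', -, hy'⟩
    have := (h _).1 hy'
    simp only [List.cons.injEq] at this
    exact this.1.symm
  · rintro rfl
    exact ⟨y, hy.le, (h _).2 rfl⟩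

/-- Membership in `Lᶜ` in terms of the witness. [folklore] -/
theorem not_mem_L_iff {z : List Bool} {b : Bool} {y : List Bool} (hy : y.length = z.length)
    (h : ∀ w, (rsv z w ∈ oracleC d ↔ w = b :: y)) :
    z ∉ L d ↔ ∃ y' : List Bool, y'.length ≤ z.length ∧ rsv z (false :: y') ∈ oracleC d := by
  rw [mem_L_iff d hy h]
  constructor
  · intro hb
    refine ⟨y, hy.le, (h _).2 ?_⟩
    rw [Bool.eq_false_iff.2 hb]
  · rintro ⟨y', -, hy'⟩
    have := (h _).1 hy'
    simp only [List.cons.injEq] at this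
    rw [← this.1]
    exact Bool.false_ne_true

/-- **The stage input `1^{nᵢ}` is in `L` iff the bit of stage `i` is `1`.** [cite: AroraBarakCC2009, Thm. 3.7 (proof)] -/
theorem ones_mem_L_iff (i : ℕ) : ones (lvl d i) ∈ L d ↔ (st d i).bit = true :=
  mem_L_iff d (y := (st d i).tail) (by rw [st_tail, length_stTail]; simp) (rsv_ones_mem_oracleC_iff d i)

/-! ### Candidates and the count -/

/-- The candidate witnesses `b :: y`, `|y| = n`. [folklore] -/
def cands (b : Bool) (n : ℕ) : Finset (List Bool) :=
  (Finset.univ : Finset (List.Vector Bool n)).image fun v => b :: v.1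

/-- Membership in the candidate set. [folklore] -/
theorem mem_cands {b : Bool} {n : ℕ} {w : List Bool} : w ∈ cands b n ↔ ∃ y : List Bool, y.length = n ∧ w = b :: y := by
  simp only [cands, Finset.mem_image, Finset.mem_univ, true_and]
  constructor
  · rintro ⟨v, rfl⟩
    exact ⟨v.1, v.2, rfl⟩
  · rintro ⟨y, hy, rfl⟩
    exact ⟨⟨y, hy⟩, rfl⟩

/-- There are `2ⁿ` candidates. [folklore] -/
theorem card_cands (b : Bool) (n : ℕ) : (cands b n).card = 2 ^ n := by
  rw [cands, Finset.card_image_of_injective, Finset.card_univ, card_vector, Fintype.card_bool]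
  intro v w h
  exact List.Vector.toList_injective (List.cons_injective h)

/-- **The count**: `2ᵐ · (144 · 4ᵐ)ᵐ < 2^{m⁴}` for `m ≥ 3` (the exponent on the left is
`2m² + 9m ≤ m⁴`). [folklore] -/
theorem count_lt {m : ℕ} (hm : 3 ≤ m) : 2 ^ m * (144 * 4 ^ m) ^ m < 2 ^ (m ^ 4) := by
  have h1 : 144 * 4 ^ m < 2 ^ (2 * m + 8) := by
    rw [pow_add, pow_mul]
    norm_num
    linarith [Nat.one_le_pow m 4 (by norm_num)]
  have h2 : (144 * 4 ^ m) ^ m < (2 ^ (2 * m + 8)) ^ m := Nat.pow_lt_pow_left h1 (by omega)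
  have h3 : m + (2 * m + 8) * m ≤ m ^ 4 := by
    have h9 : 9 ≤ m * m := by nlinarith
    have : m ^ 4 = (m * m) * (m * m) := by ring
    rw [this]
    nlinarith
  calc 2 ^ m * (144 * 4 ^ m) ^ m < 2 ^ m * (2 ^ (2 * m + 8)) ^ m :=
        Nat.mul_lt_mul_of_pos_left h2 (by positivity)
    _ = 2 ^ (m + (2 * m + 8) * m) := by rw [← pow_mul, ← pow_add]
    _ ≤ 2 ^ (m ^ 4) := Nat.pow_le_pow_right (by norm_num) h3

/-! ### `UP`-verifiers for `L` and its complement -/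

/-- The verifier map `⟨z, y⟩ ↦ rsv z (b :: y)`. [folklore] -/
def verFn (b : Bool) : List Bool → List Bool :=
  List.cons false ∘ fanoutFn Brick.fstF (List.cons b ∘ Brick.sndF)

/-- Semantics of the verifier map. [folklore] -/
@[simp] theorem verFn_boolPair (b : Bool) (z y : List Bool) : verFn b (boolPair z y) = rsv z (b :: y) := by
  simp [verFn, rsv]

/-- The verifier map is in `FP`. [cite: AroraBarakCC2009, §1.3 and Thm. 2.8] -/
theorem verFn_mem_FP (b : Bool) : verFn b ∈ FP :=
  comp_mem_FP (cons_mem_FP false)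
    (fanoutFn_mem_FP Brick.fstF_mem_FP (comp_mem_FP (cons_mem_FP b) Brick.sndF_mem_FP))

/-- The verifier language `{u | verFn b u ∈ C}` is in `P^C` (a Karp preimage of `C ∈ P^C`).
[cite: BakerGillSolovay1975, §1] -/
theorem preimage_verFn_mem_PRel (b : Bool) :
    verFn b ⁻¹' oracleC d ∈ PRel (Oracle.ofLanguage (oracleC d)) :=
  mem_PRel_of_karpReducible ⟨verFn b, verFn_mem_FP b, fun _ => Iff.rfl⟩
    (self_mem_PRel_ofLanguage_holds _)

/-- **`L ∈ UP^C`**, unfolded: a `P^C` verifier with witness bound `X` and unique witnesses.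
[cite: FortnowRogers1999JCSS, proof of Thm. 4.2 ("L^G ∈ UP^G ∩ coUP^G")] -/
theorem L_verifier :
    ∃ L' ∈ PRel (Oracle.ofLanguage (oracleC d)), ∃ p : Polynomial ℕ,
      (∀ x : List Bool, x ∈ L d ↔ ∃ y : List Bool, y.length ≤ p.eval x.length ∧ boolPair x y ∈ L') ∧
        ∀ x : List Bool, {y : List Bool | y.length ≤ p.eval x.length ∧ boolPair x y ∈ L'}.Subsingleton := by
  refine ⟨verFn true ⁻¹' oracleC d, preimage_verFn_mem_PRel d true, X, fun x => ?_, fun x => ?_⟩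
  · change x ∈ L d ↔ ∃ y : List Bool, y.length ≤ X.eval x.length ∧ verFn true (boolPair x y) ∈ oracleC d
    simp only [eval_X, verFn_boolPair]
    rfl
  · intro y hy y' hy'
    change y.length ≤ X.eval x.length ∧ verFn true (boolPair x y) ∈ oracleC d at hy
    change y'.length ≤ X.eval x.length ∧ verFn true (boolPair x y') ∈ oracleC d at hy'
    rw [verFn_boolPair] at hy hy'
    obtain ⟨b, y₀, -, h⟩ := exists_wit d x
    have h1 := (h _).1 hy.2
    have h2 := (h _).1 hy'.2
    simp only [List.cons.injEq] at h1 h2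
    rw [h1.2, h2.2]

/-- **`Lᶜ ∈ UP^C`**, unfolded (every string has exactly one witness, so `Lᶜ` is the set of strings
whose witness starts with `0`). [cite: FortnowRogers1999JCSS, proof of Thm. 4.2 ("L^G ∈ UP^G ∩ coUP^G")] -/
theorem Lc_verifier :
    ∃ L' ∈ PRel (Oracle.ofLanguage (oracleC d)), ∃ p : Polynomial ℕ,
      (∀ x : List Bool, x ∈ (L d)ᶜ ↔ ∃ y : List Bool, y.length ≤ p.eval x.length ∧ boolPair x y ∈ L') ∧
        ∀ x : List Bool, {y : List Bool | y.length ≤ p.eval x.length ∧ boolPair x y ∈ L'}.Subsingleton := by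
  refine ⟨verFn false ⁻¹' oracleC d, preimage_verFn_mem_PRel d false, X, fun x => ?_, fun x => ?_⟩
  · change x ∉ L d ↔ ∃ y : List Bool, y.length ≤ X.eval x.length ∧ verFn false (boolPair x y) ∈ oracleC d
    simp only [eval_X, verFn_boolPair]
    obtain ⟨b, y₀, hy₀, h⟩ := exists_wit d x
    exact not_mem_L_iff d hy₀ h
  · intro y hy y' hy'
    change y.length ≤ X.eval x.length ∧ verFn false (boolPair x y) ∈ oracleC d at hy
    change y'.length ≤ X.eval x.length ∧ verFn false (boolPair x y') ∈ oracleC d at hy'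
    rw [verFn_boolPair] at hy hy'
    obtain ⟨b, y₀, -, h⟩ := exists_wit d x
    have h1 := (h _).1 hy.2
    have h2 := (h _).1 hy'.2
    simp only [List.cons.injEq] at h1 h2
    rw [h1.2, h2.2]

end FRO

end Literature.Computability.QuantumComplexity

end
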